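import Mathlib
import Summits.Ventures.PercRepro2.Graph
import Summits.Ventures.PercRepro2.Exploration
import Summits.Ventures.PercRepro2.Harris
import Summits.Ventures.PercRepro2.GibbsPAJoint

/-!
# The separated cluster — the joint law of the two explored clusters (blind cell PercRepro2,
p3 g12, 2026-08-27; `proofs/P3-G2.md` §2, single-root form `X = {x}`, `Y = {y}`)

Part 1 of the formalisation of Theorem A of `P3-G2.md`.  Objects: the separation event
`sepEvent ends x y = {x ↮ y}`, the cluster of a vertex explored away from a set
(`clAway ends D v ω = C_{G − D}(v)`, the cluster in the configuration with every edge touching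
`D` closed), and the joint law `J D K = P(C(y) = D, C(x) = K, x ↮ y) / P(x ↮ y)`.  Results: the
monotonicity of `restrict`, the pushforward / partition identities for a function of an explored
cluster, and the DOMAIN-MARKOV form of the joint law (`prob_joint_eq`, `prob_joint_eq'`): on
`{C(y) = D}` with `x ∉ D` the cluster of `x` is its cluster in `G − D`, so
`P(C(y) = D, C(x) = K, S) = P(C(y) = D) · P(C_{G − D}(x) = K)` (from the cell's
`prob_clusterEvent_inter_eq_mul` and `conn_restrict_iff_of_cluster_eq`), and the two marginals
(`sum_J_right`, `sum_J_left`).  Own work; standard axioms.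
-/

namespace Summit.Ventures.PercRepro2

namespace SepPA

open Finset Classical

section General

variable {V : Type*} {E : Type*}

/-- `restrict` is monotone in the configuration. -/
lemma restrict_mono (F : Set E) [DecidablePred (· ∈ F)] {ω ω' : Config E} (h : ω ≤ ω') :
    restrict F ω ≤ restrict F ω' := by
  intro e
  rw [Bool.le_iff_imp]
  intro he
  rw [restrict_eq_true_iff] at he ⊢
  exact ⟨Bool.le_iff_imp.mp (h e) he.1, he.2⟩

/-- `restrict` is monotone in the set of kept edges. -/
lemma restrict_le_restrict_of_subset {F F' : Set E} [DecidablePred (· ∈ F)]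
    [DecidablePred (· ∈ F')] (hF : F ⊆ F') (ω : Config E) : restrict F ω ≤ restrict F' ω := by
  intro e
  rw [Bool.le_iff_imp]
  intro he
  rw [restrict_eq_true_iff] at he ⊢
  exact ⟨he.1, hF he.2⟩

/-- If every edge touching `v` is closed, the cluster of `v` is `{v}`. -/
lemma cluster_eq_singleton_of_closed {ends : E → Sym2 V} {ω : Config E} {v : V}
    (h : ∀ e ∈ touches ends {v}, ω e = false) : cluster ends ω v = {v} := by
  apply Set.Subset.antisymm
  · intro u hu
    have key : u ∈ ({v} : Set V) := by
      refine mem_of_conn_of_closed (ends := ends) (ω := ω) ?_ (Set.mem_singleton v) hu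
      intro a ha b hab
      obtain ⟨_, e, he, hends⟩ := openGraph_adj.1 hab
      have : e ∈ touches ends {v} := ⟨a, ha, b, hends⟩
      rw [h e this] at he
      exact absurd he Bool.false_ne_true
    exact key
  · intro u hu
    rw [Set.mem_singleton_iff] at hu
    rw [hu]
    exact mem_cluster_self ends ω v

end General

section Pushforward

variable {E : Type*} [Fintype E] [DecidableEq E] {T : Type*} [Fintype T]

/-- The expectation of `1_A · g ∘ c` is the sum over the values of `c` of `P(A ∩ {c = t}) · g t`. -/
theorem expect_indicator_comp_eq_sum (p : E → ℝ) (A : Set (Config E)) (c : Config E → T)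
    (g : T → ℝ) :
    expect p (fun ω => A.indicator (fun _ => (1 : ℝ)) ω * g (c ω)) =
      ∑ t, prob p (A ∩ {ω | c ω = t}) * g t := by
  unfold expect prob
  have : ∀ t, (∑ ω, (A ∩ {ω | c ω = t}).indicator (weight p) ω) * g t =
      ∑ ω, (if ω ∈ A ∧ c ω = t then weight p ω * g t else 0) := by
    intro t
    rw [Finset.sum_mul]
    apply Finset.sum_congr rfl
    intro ω _
    by_cases h : ω ∈ A ∧ c ω = t
    · have hm : ω ∈ A ∩ {ω | c ω = t} := h
      rw [Set.indicator_of_mem hm, if_pos h]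
    · have hm : ω ∉ A ∩ {ω | c ω = t} := h
      rw [Set.indicator_of_notMem hm, if_neg h, zero_mul]
  simp_rw [this]
  rw [Finset.sum_comm]
  apply Finset.sum_congr rfl
  intro ω _
  by_cases hA : ω ∈ A
  · simp only [hA, true_and, Set.indicator_of_mem hA]
    rw [Finset.sum_ite_eq]
    simp
  · simp [hA]

/-- The partition identity: `P(A) = ∑ t, P(A ∩ {c = t})`. -/
theorem prob_eq_sum_prob_inter (p : E → ℝ) (A : Set (Config E)) (c : Config E → T) :
    prob p A = ∑ t, prob p (A ∩ {ω | c ω = t}) := by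
  have h := expect_indicator_comp_eq_sum p A c (fun _ => (1 : ℝ))
  simp only [mul_one] at h
  rw [← h, prob_eq_expect_indicator]
  rfl

end Pushforward

section SeparatedSets

variable {V : Type*} {E : Type*}
variable (ends : E → Sym2 V) (x y : V)

/-- The separation event `{x ↮ y}`. -/
def sepEvent : Set (Config E) := {ω | ¬ Conn ends ω x y}

/-- The cluster of `v` in the graph with every edge touching `D` removed. -/
noncomputable def clAway (D : Set V) (v : V) (ω : Config E) : Set V :=
  cluster ends (restrict (touches ends D)ᶜ ω) v

variable {ends x y}

/-- On `{C(y) = D}` with `x ∉ D`, the separation holds. -/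
lemma mem_sepEvent_of_cluster_eq {ω : Config E} {D : Set V} (hD : cluster ends ω y = D)
    (hx : x ∉ D) : ω ∈ sepEvent ends x y := by
  intro h
  apply hx
  rw [← hD]
  exact conn_symm h

/-- On `{C(x) = K}` with `y ∉ K`, the separation holds. -/
lemma mem_sepEvent_of_cluster_eq' {ω : Config E} {K : Set V} (hK : cluster ends ω x = K)
    (hy : y ∉ K) : ω ∈ sepEvent ends x y := by
  intro h
  apply hy
  rw [← hK]
  exact h

/-- On `{C(y) = D} ∩ {x ↮ y}`, `x ∉ D`. -/
lemma not_mem_of_mem_sepEvent {ω : Config E} {D : Set V} (hD : cluster ends ω y = D)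
    (hS : ω ∈ sepEvent ends x y) : x ∉ D := by
  intro hx
  apply hS
  rw [← hD] at hx
  exact conn_symm hx

/-- On `{C(x) = K} ∩ {x ↮ y}`, `y ∉ K`. -/
lemma not_mem_of_mem_sepEvent' {ω : Config E} {K : Set V} (hK : cluster ends ω x = K)
    (hS : ω ∈ sepEvent ends x y) : y ∉ K := by
  intro hy
  apply hS
  rw [← hK] at hy
  exact hy

/-- The joint event, seen from the explored cluster of `y` (`x ∉ D`): the cluster of `x` is the
cluster of `x` in the graph with the edges touching `D` removed. -/
lemma joint_eq_clAway {D : Set V} (hx : x ∉ D) (K : Set V) :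
    clusterEvent ends y D ∩ clusterEvent ends x K ∩ sepEvent ends x y =
      clusterEvent ends y D ∩ {ω | clAway ends D x ω = K} := by
  ext ω
  simp only [Set.mem_inter_iff, mem_clusterEvent, Set.mem_setOf_eq, clAway]
  constructor
  · rintro ⟨⟨hD, hK⟩, -⟩
    refine ⟨hD, ?_⟩
    rw [← hK]
    ext w
    simp only [mem_cluster]
    exact conn_restrict_iff_of_cluster_eq hD hx
  · rintro ⟨hD, hK⟩
    refine ⟨⟨hD, ?_⟩, mem_sepEvent_of_cluster_eq hD hx⟩
    rw [← hK]
    ext w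
    simp only [mem_cluster]
    exact (conn_restrict_iff_of_cluster_eq hD hx).symm

/-- The joint event, seen from the explored cluster of `x` (`y ∉ K`). -/
lemma joint_eq_clAway' {K : Set V} (hy : y ∉ K) (D : Set V) :
    clusterEvent ends y D ∩ clusterEvent ends x K ∩ sepEvent ends x y =
      clusterEvent ends x K ∩ {ω | clAway ends K y ω = D} := by
  ext ω
  simp only [Set.mem_inter_iff, mem_clusterEvent, Set.mem_setOf_eq, clAway]
  constructor
  · rintro ⟨⟨hD, hK⟩, -⟩
    refine ⟨hK, ?_⟩
    rw [← hD]
    ext w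
    simp only [mem_cluster]
    exact conn_restrict_iff_of_cluster_eq hK hy
  · rintro ⟨hK, hD⟩
    refine ⟨⟨?_, hK⟩, mem_sepEvent_of_cluster_eq' hK hy⟩
    rw [← hD]
    ext w
    simp only [mem_cluster]
    exact (conn_restrict_iff_of_cluster_eq hK hy).symm

end SeparatedSets

section Separated

variable {V : Type*} {E : Type*} [Fintype V] [Fintype E] [DecidableEq E]
variable (ends : E → Sym2 V) (p : E → ℝ) (x y : V)

/-- The joint law of `(C(y), C(x))` under `P(· | x ↮ y)`. -/
noncomputable def J (D K : Set V) : ℝ :=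
  prob p (clusterEvent ends y D ∩ clusterEvent ends x K ∩ sepEvent ends x y) /
    prob p (sepEvent ends x y)

omit [Fintype V] in
/-- **Domain Markov for the joint law** (`x ∉ D`):
`P(C(y) = D, C(x) = K, x ↮ y) = P(C(y) = D) · P(C_{G − D}(x) = K)`. -/
theorem prob_joint_eq {D : Set V} (hx : x ∉ D) (K : Set V) :
    prob p (clusterEvent ends y D ∩ clusterEvent ends x K ∩ sepEvent ends x y) =
      prob p (clusterEvent ends y D) * prob p {ω | clAway ends D x ω = K} := by
  rw [joint_eq_clAway hx K]
  exact prob_clusterEvent_inter_eq_mul p ends y D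
    (dependsOn_restrict (touches ends D)ᶜ fun ω' => cluster ends ω' x = K) disjoint_compl_right

omit [Fintype V] in
/-- **Domain Markov for the joint law**, from the `x` side (`y ∉ K`). -/
theorem prob_joint_eq' {K : Set V} (hy : y ∉ K) (D : Set V) :
    prob p (clusterEvent ends y D ∩ clusterEvent ends x K ∩ sepEvent ends x y) =
      prob p (clusterEvent ends x K) * prob p {ω | clAway ends K y ω = D} := by
  rw [joint_eq_clAway' hy D]
  exact prob_clusterEvent_inter_eq_mul p ends x K
    (dependsOn_restrict (touches ends K)ᶜ fun ω' => cluster ends ω' y = D) disjoint_compl_right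

/-- The `y`-marginal of the joint law: `∑ K, J D K = P(C(y) = D, x ↮ y) / P(x ↮ y)`. -/
theorem sum_J_right (D : Set V) :
    ∑ K, J ends p x y D K =
      prob p (clusterEvent ends y D ∩ sepEvent ends x y) / prob p (sepEvent ends x y) := by
  unfold J
  rw [← Finset.sum_div]
  congr 1
  rw [prob_eq_sum_prob_inter p (clusterEvent ends y D ∩ sepEvent ends x y)
    (fun ω => cluster ends ω x)]
  apply Finset.sum_congr rfl
  intro K _
  congr 1
  ext ω
  simp only [Set.mem_inter_iff, mem_clusterEvent, Set.mem_setOf_eq]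
  tauto

/-- The `x`-marginal of the joint law: `∑ D, J D K = P(C(x) = K, x ↮ y) / P(x ↮ y)`. -/
theorem sum_J_left (K : Set V) :
    ∑ D, J ends p x y D K =
      prob p (clusterEvent ends x K ∩ sepEvent ends x y) / prob p (sepEvent ends x y) := by
  unfold J
  rw [← Finset.sum_div]
  congr 1
  rw [prob_eq_sum_prob_inter p (clusterEvent ends x K ∩ sepEvent ends x y)
    (fun ω => cluster ends ω y)]
  apply Finset.sum_congr rfl
  intro D _
  congr 1
  ext ω
  simp only [Set.mem_inter_iff, mem_clusterEvent, Set.mem_setOf_eq]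
  tauto

end Separated

end SepPA

end Summit.Ventures.PercRepro2
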